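import Summits.QuantumFields.YangMills.Theorems.BalabanUVNodesN15KingModelFullPropagatorL2LocalSecondOrder
import Summits.QuantumFields.YangMills.Theorems.BalabanUVNodesN15KingModelFullPropagatorL2LocalMixed
import Literature.MathematicalPhysics.QuantumFieldTheory.Balaban1983to89.B9Ineq346SecondOrderTorusCore
import HarnessLib

/-!
# BalabanUVNodes ∕ N15 — THE KING-MODEL RUNG, CURVED EDITION (PART Υ-c): [B9] (3.46) AT `U ≡ 1`, THE SIXTH ENTRY `‖h·A₀⁻¹∇*_μ∇*_νλ‖ ≤ C·|h|_∞·e^{−δ|b − b′|}·‖λ‖`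
# (the fifth entry TRANSPOSED) and THE SIX-ENTRY `L²` PACKAGE for King's full `A = 0` propagator, UNIFORMLY in `K`, the volume and the mass
# (Track A, DAG node N15 = NE2; FAN-OUT v1.1 §N15 s3 «KING-MODEL RUNG … + the one-line statement of what the curved case adds»)

HONEST FRAMING.  Count-neutral operator bookkeeping (cell `pub-ymgap`, seat `pub-ymgap-dag-n15-e` g17; `--supports stmt-QuantumFields-27366 --as helper` =
K3⁸ `SpineGivenEndpointR13SepCoPHV`).  TEMPLATE LITERATURE, `A = 0`: C. King's scalar U(1)-Higgs MODEL on finite tori ([King1986] (2.13) p. 653, (4.1)–(4.5)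
p. 670), NOT Bałaban's covariant objects.  [Balaban1985BackgroundPropagators] Thm 3.1 (3.46) p. 398: «`‖hG′(U)λ‖, ‖h∇_UG′(U)λ‖, ‖hG′(U)∇*_Uλ‖,
‖h∇_UG′(U)∇*_Uλ‖, ‖h∇_U∇_UG′(U)λ‖, ‖hG′(U)∇*_U∇*_Uλ‖ ≦ B₀[(L^jη)², L^jη, L^jη, 1, 1, 1]|h|e^{−δ₀d(y,y′)}‖λ‖`».  At `U ≡ 1`, for King's full `A = 0` propagator
`A₀⁻¹` (`A₀ = N²(−Δ) + m² + a_KQ*Q`, symmetric: `King1986.Torus.fineOp_transpose`), the sixth member is the TRANSPOSE of the fifth: `A₀⁻¹∇*_μ∇*_ν = (∇_ν∇_μA₀⁻¹)ᵀ`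
(`∇* = ∇ᵀ` for the plain `ℓ²` sum), so part Υ-b's fifth entry with the roles of the two blocks exchanged gives it, through the lit-balaban N06 lane's generic
duality `B9Ineq346SecondOrderTorusCore.transpose_block_bound` (IMPORTED BY NAME — it is carrier-free; [B9] p. 398 «we may always replace ∇_U by ∇*_U»).
§2 assembles ALL SIX localised (3.46) members at `U ≡ 1` under ONE `(C, δ)`: part Ξ-b's four (`kingFullProp_B9Thm31_l2_local_at_trivialU`) + Υ-b's fifth +
this sixth — the rung's [B9] Thm 3.1 map has no open cell left at `U ≡ 1` ((3.42)–(3.45): part Ψ-e `kingFullProp_B9Thm31_at_trivialU`; (3.46): here).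
Decided in the MODEL; NOT the printed proposition (covariant `G(U)`, `Reg335`, multiscale sites); NE2⁺ is NOT PRINTED and not proved; NOT a node
discharge; nothing continuum ∕ ℝ⁴ ∕ OS ∕ mass-gap ∕ Clay.  0 `sorry`, 0 `def`, standard axioms.
* §1 `hessMat` is NOT a definition: the matrix `x, y ↦ N²(A(x+e_μ+e_ν, y) − A(x+e_μ, y) − A(x+e_ν, y) + A(x, y))` is written inline (`Matrix.of`);
  `hessMat_mulVec` (it acts as `N²∂_μ∂_ν(A·)`), `hessMat_transpose_mulVec` (its transpose acts as `A(∇*_μ∇*_ν ·)` for symmetric `A`),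
  ★★ **`fullPropAdjHessOp_l2_local`** — `∃ C δ > 0 ∀ K ≥ 1 ∀ N = L^K ∀ cube 2L^e ∀ 0 < m² ≤ m₀² ∀ μ ν λ h H_h b b′`:
  `Σ_x (h(x)·(A₀⁻¹(∇*_μ∇*_νλ))(x))² ≤ (C·H_h·e^{−δ|b−b′|})²·Σ_zλ(z)²`, `(∇*_μ∇*_νλ)(y) = N²(λ(y−e_μ−e_ν) − λ(y−e_μ) − λ(y−e_ν) + λ(y))`;
* §2 ★★★ **`kingFullProp_B9Thm31_l2_local_six_at_trivialU`** — the six localised entries `hGλ`, `h∇Gλ`, `hG∇*λ`, `h∇G∇*λ`, `h∇∇Gλ`, `hG∇*∇*λ` of (3.46) at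
  `U ≡ 1` under ONE `(C, δ)`.
WHAT THE CURVED CASE ADDS (one line): (3.46) itself for `G′(U)` over `Reg335`, all six entries with the multiscale prefactors — [B9]'s random-walk expansion (N06's row).
HONEST SCOPE.  (i) `A = 0`, periodic b.c., odd `L ≥ 3`, cubes `2L^e`, `K ≥ 1`, `0 < m² ≤ m₀²`; (ii) King's spelling, plain `ℓ²` sums, forward η-differences and
their transposes; (iii) single-block cut-off ∕ source; (iv) [B9]'s prefactors `(L^jη)², L^jη` of entries 1–3 are the printed multiscale ones — in the model the six
members are simply bounded (entries 1–3 are Ξ-a's, unchanged); (v) not Bałaban's `G(U)`; not a discharge.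
Locators: [Balaban1985BackgroundPropagators] Thm 3.1 (3.46) p. 398; [King1986] (2.13) p. 653, (4.1)–(4.5) p. 670; [Balaban1984PropagatorsII] (2.36) p. 229.
-/

noncomputable section

namespace Summit.QuantumFields.YangMills.BalabanUVNodes.N15KingModelRung.Curved

open Real Finset Matrix
open Literature.MathematicalPhysics.QuantumFieldTheory.Balaban1983to89.B5Prop11Plancherel (Tor fine unitVec)
open Literature.MathematicalPhysics.QuantumFieldTheory.Balaban1983to89.B9Ineq346SecondOrderTorusCore (transpose_block_bound)
open Literature.MathematicalPhysics.QuantumFieldTheory.King1986 (aK aK_pos aK_le)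
open Literature.MathematicalPhysics.QuantumFieldTheory.King1986.Torus (fineOp fineOp_transpose fineOp_isUnit blockOf blockProj tdistT tdistT_nonneg
  tdistT_symm)
open Summit.QuantumFields.YangMills.BalabanUVNodes.N15.KingModel (fwdDiff adjDiff lapOp fwdDiff_apply lapOp_apply)

variable {d : ℕ} (L : ℕ) [NeZero L]

/-! ## §1 The sixth entry: the fifth, transposed -/

section Transpose

variable {Kt : Fin (d + 1) → ℕ} [∀ μ, NeZero (Kt μ)]

/-- The second-difference matrix of a kernel `A` ACTS as `n²∂_μ∂_ν(A·)`:
`(H g)(x) = n²((Ag)(x+e_μ+e_ν) − (Ag)(x+e_μ) − (Ag)(x+e_ν) + (Ag)(x))`. [folklore] -/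
theorem hessMat_mulVec (n : ℝ) (A : Matrix (Tor Kt) (Tor Kt) ℝ) (μ ν : Fin (d + 1)) (g : Tor Kt → ℝ) (x : Tor Kt) :
    (Matrix.of (fun x y => n ^ 2 * (A (x + unitVec Kt μ + unitVec Kt ν) y - A (x + unitVec Kt μ) y - A (x + unitVec Kt ν) y + A x y)) *ᵥ g) x
      = n ^ 2 * ((A *ᵥ g) (x + unitVec Kt μ + unitVec Kt ν) - (A *ᵥ g) (x + unitVec Kt μ) - (A *ᵥ g) (x + unitVec Kt ν) + (A *ᵥ g) x) := by
  simp only [Matrix.mulVec, dotProduct, Matrix.of_apply]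
  rw [mul_add, mul_sub, mul_sub, Finset.mul_sum, Finset.mul_sum, Finset.mul_sum, Finset.mul_sum, ← Finset.sum_sub_distrib,
    ← Finset.sum_sub_distrib, ← Finset.sum_add_distrib]
  exact Finset.sum_congr rfl fun y _ => by ring

/-- … and its TRANSPOSE acts, for SYMMETRIC `A`, as `A(∇*_μ∇*_ν ·)`:
`(Hᵀλ)(y) = (A λ₂)(y)`, `λ₂(x) = n²(λ(x−e_μ−e_ν) − λ(x−e_μ) − λ(x−e_ν) + λ(x))` (translation invariance of the torus sums). [folklore] -/
theorem hessMat_transpose_mulVec (n : ℝ) (A : Matrix (Tor Kt) (Tor Kt) ℝ) (hA : Aᵀ = A) (μ ν : Fin (d + 1)) (lam : Tor Kt → ℝ) (y : Tor Kt) :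
    ((Matrix.of (fun x y => n ^ 2 * (A (x + unitVec Kt μ + unitVec Kt ν) y - A (x + unitVec Kt μ) y - A (x + unitVec Kt ν) y + A x y)))ᵀ *ᵥ lam) y
      = (A *ᵥ (fun x => n ^ 2 * (lam (x - unitVec Kt μ - unitVec Kt ν) - lam (x - unitVec Kt μ) - lam (x - unitVec Kt ν) + lam x))) y := by
  have hsym : ∀ x z, A x z = A z x := fun x z => by
    have := congrFun (congrFun hA z) x
    rw [Matrix.transpose_apply] at this
    exact this
  simp only [Matrix.mulVec, dotProduct, Matrix.transpose_apply, Matrix.of_apply]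
  -- split the left sum into four translated sums
  have e1 : ∑ x, n ^ 2 * (A (x + unitVec Kt μ + unitVec Kt ν) y - A (x + unitVec Kt μ) y - A (x + unitVec Kt ν) y + A x y) * lam x
      = n ^ 2 * (∑ x, A (x + unitVec Kt μ + unitVec Kt ν) y * lam x - ∑ x, A (x + unitVec Kt μ) y * lam x
          - ∑ x, A (x + unitVec Kt ν) y * lam x + ∑ x, A x y * lam x) := by
    rw [← Finset.sum_sub_distrib, ← Finset.sum_sub_distrib, ← Finset.sum_add_distrib, Finset.mul_sum]
    exact Finset.sum_congr rfl fun x _ => by ring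
  have s1 : ∑ x, A (x + unitVec Kt μ + unitVec Kt ν) y * lam x = ∑ x, A x y * lam (x - unitVec Kt μ - unitVec Kt ν) := by
    rw [← sum_comp_sub_torus Kt (fun x => A (x + unitVec Kt μ + unitVec Kt ν) y * lam x) (unitVec Kt μ + unitVec Kt ν)]
    refine Finset.sum_congr rfl fun x _ => ?_
    have hx : x - (unitVec Kt μ + unitVec Kt ν) + unitVec Kt μ + unitVec Kt ν = x := by abel
    rw [hx, sub_sub]
  have s2 : ∑ x, A (x + unitVec Kt μ) y * lam x = ∑ x, A x y * lam (x - unitVec Kt μ) := by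
    rw [← sum_comp_sub_torus Kt (fun x => A (x + unitVec Kt μ) y * lam x) (unitVec Kt μ)]
    exact Finset.sum_congr rfl fun x _ => by rw [sub_add_cancel]
  have s3 : ∑ x, A (x + unitVec Kt ν) y * lam x = ∑ x, A x y * lam (x - unitVec Kt ν) := by
    rw [← sum_comp_sub_torus Kt (fun x => A (x + unitVec Kt ν) y * lam x) (unitVec Kt ν)]
    exact Finset.sum_congr rfl fun x _ => by rw [sub_add_cancel]
  rw [e1, s1, s2, s3]
  rw [show (∑ x, A y x * (n ^ 2 * (lam (x - unitVec Kt μ - unitVec Kt ν) - lam (x - unitVec Kt μ) - lam (x - unitVec Kt ν) + lam x)))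
      = ∑ x, (n ^ 2 * (A x y * lam (x - unitVec Kt μ - unitVec Kt ν)) - n ^ 2 * (A x y * lam (x - unitVec Kt μ))
          - n ^ 2 * (A x y * lam (x - unitVec Kt ν)) + n ^ 2 * (A x y * lam x))
      from Finset.sum_congr rfl fun x _ => by rw [hsym y x]; ring]
  rw [Finset.sum_add_distrib, Finset.sum_sub_distrib, Finset.sum_sub_distrib, ← Finset.mul_sum, ← Finset.mul_sum, ← Finset.mul_sum,
    ← Finset.mul_sum]
  ring

end Transpose

/-- ★★ **ENTRY 6 OF (3.46) AT `U ≡ 1`, LOCALISED — `‖h·A₀⁻¹∇*_μ∇*_νλ‖ ≤ C·|h|_∞·e^{−δ|b−b′|}·‖λ‖`**: for odd `L ≥ 3`, `a > 0` and a mass cap `m₀² ≥ 0` there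
are `C, δ > 0` such that for EVERY `K ≥ 1` (`N = L^K`), cube `M_μ = 2L^e`, mass `0 < m² ≤ m₀²`, directions `μ, ν`, source `λ` supported in the block `b′`
and cut-off `h` supported in the block `b` with `|h| ≤ H_h`:
`Σ_x (h(x)·(A₀⁻¹λ₂)(x))² ≤ (C·H_h·e^{−δ|b−b′|})²·Σ_z λ(z)²`, `λ₂(y) = N²(λ(y−e_μ−e_ν) − λ(y−e_μ) − λ(y−e_ν) + λ(y)) = (∇*_μ∇*_νλ)(y)` — part Υ-b's fifth
entry with the blocks exchanged, transposed (`A₀⁻¹` symmetric). [cite: Balaban1985BackgroundPropagators, Thm 3.1 (3.46) p.398 (sixth entry, shape; «we may always replace ∇_U by ∇*_U»); King1986, (2.13) p.653, (4.1)–(4.5) p.670] -/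
theorem fullPropAdjHessOp_l2_local (hLodd : Odd L) (hL : 2 ≤ L) {a : ℝ} (ha : 0 < a) {m0sq : ℝ} (hm0 : 0 ≤ m0sq) :
    ∃ C δ : ℝ, 0 < C ∧ 0 < δ ∧ ∀ (K : ℕ), 1 ≤ K → ∀ (N : ℕ) [NeZero N], N = L ^ K →
      ∀ (e : ℕ) (M : Fin (d + 1) → ℕ) [∀ μ, NeZero (M μ)], (∀ μ, M μ = 2 * L ^ e) →
      ∀ (msq : ℝ), 0 < msq → msq ≤ m0sq → ∀ (μ ν : Fin (d + 1)) (lam h : Tor (fine N M) → ℝ) (Hh : ℝ) (b b' : Tor M), 0 ≤ Hh →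
        (∀ x, |h x| ≤ Hh) → (∀ x, h x ≠ 0 → blockOf N M x = b) → (∀ z, lam z ≠ 0 → blockOf N M z = b') →
        ∑ x, (h x * ((fineOp N M (aK a L K) (((N : ℕ) : ℝ) ^ 2) msq)⁻¹
            *ᵥ (fun y => (N : ℝ) ^ 2 * (lam (y - unitVec (fine N M) μ - unitVec (fine N M) ν) - lam (y - unitVec (fine N M) μ)
                - lam (y - unitVec (fine N M) ν) + lam y))) x) ^ 2
          ≤ (C * Hh * Real.exp (-(δ * tdistT M b b'))) ^ 2 * ∑ z, lam z ^ 2 := by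
  classical
  obtain ⟨C, δ, hC, hδ, H5⟩ := fullPropHessOp_l2_local (d := d) L hLodd hL ha hm0
  refine ⟨C, δ, hC, hδ, ?_⟩
  intro K hK N _ hN e M _ hM msq hmsq hcap μ ν lam h Hh b b' hHh hh hsh hsl
  have hL1 : (1 : ℝ) < L := by exact_mod_cast (show 1 < L by omega)
  have haK0 : 0 < aK a L K := aK_pos ha hL1 hK
  set A := (fineOp N M (aK a L K) (((N : ℕ) : ℝ) ^ 2) msq)⁻¹ with hAdef
  have hAt : Aᵀ = A := by
    rw [hAdef, Matrix.transpose_nonsing_inv, fineOp_transpose]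
  set T : Matrix (Tor (fine N M)) (Tor (fine N M)) ℝ := Matrix.of (fun x y => (N : ℝ) ^ 2 *
    (A (x + unitVec (fine N M) μ + unitVec (fine N M) ν) y - A (x + unitVec (fine N M) μ) y - A (x + unitVec (fine N M) ν) y + A x y)) with hT
  set S := ∑ z, lam z ^ 2 with hS
  set Kc : ℝ := (C * Real.exp (-(δ * tdistT M b b'))) ^ 2 with hKc
  have hKc0 : 0 ≤ Kc := sq_nonneg _
  -- entry 5 with the blocks exchanged: cut-off = indicator of `b′`, source supported in `b`
  have h5 : ∀ g : Tor (fine N M) → ℝ, (∀ z, z ∉ Finset.univ.filter (fun z => blockOf N M z = b) → g z = 0) →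
      ∑ x ∈ Finset.univ.filter (fun x => blockOf N M x = b'), ((T *ᵥ g) x) ^ 2 ≤ Kc * ∑ z, g z ^ 2 := by
    intro g hg
    have hg' : ∀ z, g z ≠ 0 → blockOf N M z = b := fun z hz => by
      by_contra hne
      exact hz (hg z (by simp [hne]))
    have h := H5 K hK N hN e M hM msq hmsq hcap μ ν g (fun x => if blockOf N M x = b' then (1 : ℝ) else 0) 1 b' b zero_le_one
      (fun x => by split_ifs <;> norm_num) (fun x hx => by by_contra hne; exact hx (if_neg hne)) hg'
    rw [← hAdef, mul_one, tdistT_symm] at h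
    rw [Finset.sum_filter]
    refine (le_of_eq (Finset.sum_congr rfl fun x _ => ?_)).trans h
    rw [hT, hessMat_mulVec]
    split_ifs with hx
    · rw [one_mul]
    · rw [zero_mul, zero_pow two_ne_zero]
  have hlam' : ∀ z, z ∉ Finset.univ.filter (fun z => blockOf N M z = b') → lam z = 0 := fun z hz => by
    by_contra hne
    exact hz (by simp [hsl z hne])
  have hdual := transpose_block_bound T (Finset.univ.filter (fun z => blockOf N M z = b)) (Finset.univ.filter (fun x => blockOf N M x = b'))
    hKc0 h5 lam hlam'
  -- read the transpose as `A(∇*∇*λ)` and insert `h`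
  have hrew : ∀ x, (A *ᵥ (fun y => (N : ℝ) ^ 2 * (lam (y - unitVec (fine N M) μ - unitVec (fine N M) ν) - lam (y - unitVec (fine N M) μ)
      - lam (y - unitVec (fine N M) ν) + lam y))) x = (Tᵀ *ᵥ lam) x := fun x => by
    rw [hT, hessMat_transpose_mulVec (N : ℝ) A hAt μ ν lam x]
  calc ∑ x, (h x * (A *ᵥ (fun y => (N : ℝ) ^ 2 * (lam (y - unitVec (fine N M) μ - unitVec (fine N M) ν) - lam (y - unitVec (fine N M) μ)
          - lam (y - unitVec (fine N M) ν) + lam y))) x) ^ 2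
      = ∑ x, (h x) ^ 2 * ((Tᵀ *ᵥ lam) x) ^ 2 := Finset.sum_congr rfl fun x _ => by rw [hrew x, mul_pow]
    _ ≤ ∑ x, (if blockOf N M x = b then Hh ^ 2 * ((Tᵀ *ᵥ lam) x) ^ 2 else 0) := by
        refine Finset.sum_le_sum fun x _ => ?_
        by_cases hx : h x = 0
        · rw [hx]; split_ifs <;> simp; positivity
        · rw [if_pos (hsh x hx)]
          exact mul_le_mul_of_nonneg_right (by have := hh x; exact sq_le_sq' (abs_le.mp this).1 (abs_le.mp this).2) (sq_nonneg _)
    _ = Hh ^ 2 * ∑ x ∈ Finset.univ.filter (fun z => blockOf N M z = b), ((Tᵀ *ᵥ lam) x) ^ 2 := by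
        rw [Finset.sum_filter, Finset.mul_sum]
        exact Finset.sum_congr rfl fun x _ => by split_ifs <;> simp
    _ ≤ Hh ^ 2 * (Kc * S) := mul_le_mul_of_nonneg_left hdual (sq_nonneg _)
    _ = (C * Hh * Real.exp (-(δ * tdistT M b b'))) ^ 2 * S := by rw [hKc]; ring

/-! ## §2 The six-entry package -/

/-- ★★★ **[B9] THEOREM 3.1 (3.46) AT `U ≡ 1`, ALL SIX `L²` ENTRIES, FOR KING'S FULL `A = 0` PROPAGATOR** — the localised entries
`hGλ`, `h∇_μGλ`, `hG∇*_νλ`, `h∇_μ′G∇*_μλ`, `h∇_μ∇_νGλ`, `hG∇*_μ∇*_νλ` under ONE `(C, δ)`, uniformly in `K ≥ 1`, cubes `2L^e` and masses `0 < m² ≤ m₀²`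
(part Ξ-b `kingFullProp_B9Thm31_l2_local_at_trivialU` ∧ part Υ-b `fullPropHessOp_l2_local` ∧ §1). [cite: Balaban1985BackgroundPropagators, Thm 3.1 (3.46) p.398 (six entries, U ≡ 1 model); King1986, (2.13) p.653, (4.1)–(4.5) p.670] -/
theorem kingFullProp_B9Thm31_l2_local_six_at_trivialU (hLodd : Odd L) (hL : 2 ≤ L) {a : ℝ} (ha : 0 < a) {m0sq : ℝ} (hm0 : 0 ≤ m0sq) :
    ∃ C δ : ℝ, 0 < C ∧ 0 < δ ∧ ∀ (K : ℕ), 1 ≤ K → ∀ (N : ℕ) [NeZero N], N = L ^ K →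
      ∀ (e : ℕ) (M : Fin (d + 1) → ℕ) [∀ μ, NeZero (M μ)], (∀ μ, M μ = 2 * L ^ e) →
      ∀ (msq : ℝ), 0 < msq → msq ≤ m0sq → ∀ (lam h : Tor (fine N M) → ℝ) (Hh : ℝ) (b b' : Tor M), 0 ≤ Hh →
        (∀ x, |h x| ≤ Hh) → (∀ x, h x ≠ 0 → blockOf N M x = b) → (∀ z, lam z ≠ 0 → blockOf N M z = b') →
        (∑ x, (h x * ((fineOp N M (aK a L K) (((N : ℕ) : ℝ) ^ 2) msq)⁻¹ *ᵥ lam) x) ^ 2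
            ≤ (C * Hh * Real.exp (-(δ * tdistT M b b'))) ^ 2 * ∑ z, lam z ^ 2) ∧
        (∀ μ : Fin (d + 1), ∑ x, (h x * ((N : ℝ) * (((fineOp N M (aK a L K) (((N : ℕ) : ℝ) ^ 2) msq)⁻¹ *ᵥ lam) (x + unitVec (fine N M) μ)
            - ((fineOp N M (aK a L K) (((N : ℕ) : ℝ) ^ 2) msq)⁻¹ *ᵥ lam) x))) ^ 2
            ≤ (C * Hh * Real.exp (-(δ * tdistT M b b'))) ^ 2 * ∑ z, lam z ^ 2) ∧
        (∀ ν : Fin (d + 1), ∑ x, (h x * ((fineOp N M (aK a L K) (((N : ℕ) : ℝ) ^ 2) msq)⁻¹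
            *ᵥ (fun y => (N : ℝ) * (lam (y - unitVec (fine N M) ν) - lam y))) x) ^ 2
            ≤ (C * Hh * Real.exp (-(δ * tdistT M b b'))) ^ 2 * ∑ z, lam z ^ 2) ∧
        (∀ μ μ' : Fin (d + 1), ∑ x, (h x * ((N : ℝ) * (((fineOp N M (aK a L K) (((N : ℕ) : ℝ) ^ 2) msq)⁻¹
                *ᵥ (fun y => (N : ℝ) * (lam (y - unitVec (fine N M) μ) - lam y))) (x + unitVec (fine N M) μ')
            - ((fineOp N M (aK a L K) (((N : ℕ) : ℝ) ^ 2) msq)⁻¹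
                *ᵥ (fun y => (N : ℝ) * (lam (y - unitVec (fine N M) μ) - lam y))) x))) ^ 2
            ≤ (C * Hh * Real.exp (-(δ * tdistT M b b'))) ^ 2 * ∑ z, lam z ^ 2) ∧
        (∀ μ ν : Fin (d + 1), ∑ x, (h x * ((N : ℝ) ^ 2 *
            (((fineOp N M (aK a L K) (((N : ℕ) : ℝ) ^ 2) msq)⁻¹ *ᵥ lam) (x + unitVec (fine N M) μ + unitVec (fine N M) ν)
              - ((fineOp N M (aK a L K) (((N : ℕ) : ℝ) ^ 2) msq)⁻¹ *ᵥ lam) (x + unitVec (fine N M) μ)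
              - ((fineOp N M (aK a L K) (((N : ℕ) : ℝ) ^ 2) msq)⁻¹ *ᵥ lam) (x + unitVec (fine N M) ν)
              + ((fineOp N M (aK a L K) (((N : ℕ) : ℝ) ^ 2) msq)⁻¹ *ᵥ lam) x))) ^ 2
            ≤ (C * Hh * Real.exp (-(δ * tdistT M b b'))) ^ 2 * ∑ z, lam z ^ 2) ∧
        (∀ μ ν : Fin (d + 1), ∑ x, (h x * ((fineOp N M (aK a L K) (((N : ℕ) : ℝ) ^ 2) msq)⁻¹
            *ᵥ (fun y => (N : ℝ) ^ 2 * (lam (y - unitVec (fine N M) μ - unitVec (fine N M) ν) - lam (y - unitVec (fine N M) μ)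
                - lam (y - unitVec (fine N M) ν) + lam y))) x) ^ 2
            ≤ (C * Hh * Real.exp (-(δ * tdistT M b b'))) ^ 2 * ∑ z, lam z ^ 2) := by
  obtain ⟨C₄, δ₄, hC₄, hδ₄, H₄⟩ := kingFullProp_B9Thm31_l2_local_at_trivialU (d := d) L hLodd hL ha hm0
  obtain ⟨C₅, δ₅, hC₅, hδ₅, H₅⟩ := fullPropHessOp_l2_local (d := d) L hLodd hL ha hm0
  obtain ⟨C₆, δ₆, hC₆, hδ₆, H₆⟩ := fullPropAdjHessOp_l2_local (d := d) L hLodd hL ha hm0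
  set C : ℝ := max C₄ (max C₅ C₆) with hCdef
  set δ : ℝ := min δ₄ (min δ₅ δ₆) with hδdef
  have hc4 : C₄ ≤ C := le_max_left _ _
  have hc5 : C₅ ≤ C := (le_max_left _ _).trans (le_max_right _ _)
  have hc6 : C₆ ≤ C := (le_max_right _ _).trans (le_max_right _ _)
  have hd4 : δ ≤ δ₄ := min_le_left _ _
  have hd5 : δ ≤ δ₅ := (min_le_right _ _).trans (min_le_left _ _)
  have hd6 : δ ≤ δ₆ := (min_le_right _ _).trans (min_le_right _ _)
  have hδ : 0 < δ := lt_min hδ₄ (lt_min hδ₅ hδ₆)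
  have hC : 0 < C := lt_of_lt_of_le hC₄ hc4
  refine ⟨C, δ, hC, hδ, ?_⟩
  intro K hK N _ hN e M _ hM msq hmsq hcap lam h Hh b b' hHh hh hsh hsl
  have hD : 0 ≤ tdistT M b b' := tdistT_nonneg M b b'
  have hS : 0 ≤ ∑ z, lam z ^ 2 := Finset.sum_nonneg fun z _ => sq_nonneg _
  -- monotonicity of the squared bound in `(C, δ)`
  have hmono : ∀ {Ci δi : ℝ}, 0 ≤ Ci → Ci ≤ C → δ ≤ δi →
      (Ci * Hh * Real.exp (-(δi * tdistT M b b'))) ^ 2 * ∑ z, lam z ^ 2 ≤ (C * Hh * Real.exp (-(δ * tdistT M b b'))) ^ 2 * ∑ z, lam z ^ 2 := by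
    intro Ci δi hCi hCiC hδi
    refine mul_le_mul_of_nonneg_right (pow_le_pow_left₀ (by positivity) ?_ 2) hS
    have hexp : Real.exp (-(δi * tdistT M b b')) ≤ Real.exp (-(δ * tdistT M b b')) :=
      Real.exp_le_exp.mpr (by have := mul_le_mul_of_nonneg_right hδi hD; linarith)
    exact mul_le_mul (mul_le_mul_of_nonneg_right hCiC hHh) hexp (Real.exp_nonneg _) (by positivity)
  have h4 := H₄ K hK N hN e M hM msq hmsq hcap lam h Hh b b' hHh hh hsh hsl
  refine ⟨h4.1.trans (hmono hC₄.le hc4 hd4), fun μ => (h4.2.1 μ).trans (hmono hC₄.le hc4 hd4),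
    fun ν => (h4.2.2.1 ν).trans (hmono hC₄.le hc4 hd4), fun μ μ' => (h4.2.2.2 μ μ').trans (hmono hC₄.le hc4 hd4),
    fun μ ν => (H₅ K hK N hN e M hM msq hmsq hcap μ ν lam h Hh b b' hHh hh hsh hsl).trans (hmono hC₅.le hc5 hd5),
    fun μ ν => (H₆ K hK N hN e M hM msq hmsq hcap μ ν lam h Hh b b' hHh hh hsh hsl).trans (hmono hC₆.le hc6 hd6)⟩

end Summit.QuantumFields.YangMills.BalabanUVNodes.N15KingModelRung.Curved

end
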